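import Summits.KontsevichZagierPeriods.KontsevichZagierPeriods.Theorems.TerasomaMultiplicationMultiplicationAccessibleCornerStokesTheta1Facts

/-!
# `MultiplicationAccessible` (stmt-KontsevichZagierPeriods-12305), line `shifted-family-prime-sieve`:
`θ₁`-derivatives of the atoms of the corner Stokes, with the bounds that absorb `1/y`

Product/chain rule along `θ₁` on the open chart domain `W` (`x ≥ 2`, `s ≥ 3`) for `S`, `K`, `H`,
the box monomials, the bracket `B = θ₀M0 − (1−θ₁)M1 + θ₂M2` and the prefactor `P` of
`c₀ = −P θ₁ B / y`, each with the estimate used to bound `∂θ₁c₀`: `|∂θ₁S| ≤ y`, `|∂θ₁K| ≤ s`,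
`|∂θ₁B| ≤ 6xy`, and the compensated bounds `|∂θ₁H|·Z² ≤ 117y`, `∂θ₁P = P₁ + P₂` with
`|P₁|·Z² ≤ 352·s·9^{3s}·y`, `|P₂| ≤ s·9^{3s}` (the singular `∂θ₁Z ∼ (t₀t₁t₂)^{−2/3}` is
compensated by `M_k ≤ Z²`). Packaged as the sub-goal `cornerStokesTheta1Deriv`.
References: Kontsevich–Zagier 2001 §1.2 rule (3).
-/

noncomputable section

open MeasureTheory Set Real
open scoped BigOperators
open Literature.NumberTheory.Transcendental
open Literature.NumberTheory.Transcendental.KZ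

namespace Summit.KontsevichZagierPeriods.TerasomaMultiplication.MultiplicationAccessible

namespace CornerTheta1

/-- **`∂θ₁ S`** (a polynomial): `∂θ₁S = −y(θ₀ − θ₁)t₂`, so `|∂θ₁S| ≤ y` on `W`. [folklore] -/
theorem hasDerivAt_S {S : (Fin 4 → ℝ) → ℝ}
    (hS : ∀ w, S w = 1 - w 2 * ((1 - w 0 - w 1) * w 0 + (1 - w 0 - w 1) * w 1 + w 0 * w 1) +
      (w 2) ^ 2 * ((1 - w 0 - w 1) * w 0 * w 1)) {w : Fin 4 → ℝ}
    (hw : 0 < w 0 ∧ 0 < w 1 ∧ w 0 + w 1 < 1 ∧ 0 < w 2 ∧ w 2 * (1 - w 0 - w 1) < 1 ∧ w 2 * w 0 < 1 ∧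
      w 2 * w 1 < 1 ∧ 0 < w 3 ∧ w 3 < 1) :
    ∃ S' : ℝ, HasDerivAt (fun a => S (Function.update w 0 a)) S' (w 0) ∧ |S'| ≤ w 2 := by
  obtain ⟨-, -, -, ⟨h2, h2'⟩, -⟩ := basic hw
  obtain ⟨hθ1, hθ2, h01, hy, -⟩ := hw
  obtain ⟨-, -, dθ⟩ := hasDerivAt_t w
  have hid := hasDerivAt_id' (w 0)
  have e2 := ((dθ.fun_mul hid).fun_add (dθ.mul_const (w 1))).fun_add (hid.mul_const (w 1))
  have e3 := (dθ.fun_mul hid).mul_const (w 1)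
  have hd := ((e2.const_mul (w 2)).const_sub 1).fun_add (e3.const_mul (w 2 ^ 2))
  have hd' : HasDerivAt (fun a => S (Function.update w 0 a))
      (-(w 2 * ((1 - w 0 - w 1) - w 0) * (1 - w 2 * w 1))) (w 0) := by
    refine (hd.congr_of_eventuallyEq (Filter.Eventually.of_forall fun a => ?_)).congr_deriv (by ring)
    simp only [hS, update_apply]
  refine ⟨_, hd', ?_⟩
  rw [abs_neg, abs_mul, abs_mul, abs_of_pos hy, abs_of_pos h2]
  have : |1 - w 0 - w 1 - w 0| ≤ 1 := by rw [abs_le]; constructor <;> linarith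
  calc w 2 * |1 - w 0 - w 1 - w 0| * (1 - w 2 * w 1) ≤ w 2 * 1 * 1 := by gcongr
    _ = w 2 := by ring

/-- **`∂θ₁ K`**: `K = (θ₀θ₁θ₂)^{s−1}`, `∂θ₁K = θ₂(θ₀ − θ₁)(s−1)(θ₀θ₁θ₂)^{s−2}`, `|∂θ₁K| ≤ s` on `W`
(`s ≥ 2`). [folklore] -/
theorem hasDerivAt_K {s : ℚ} (hs : 3 ≤ s) {K : (Fin 4 → ℝ) → ℝ}
    (hK : ∀ w, K w = ((1 - w 0 - w 1) * w 0 * w 1) ^ ((s:ℝ) - 1)) {w : Fin 4 → ℝ}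
    (hw : 0 < w 0 ∧ 0 < w 1 ∧ w 0 + w 1 < 1 ∧ 0 < w 2 ∧ w 2 * (1 - w 0 - w 1) < 1 ∧ w 2 * w 0 < 1 ∧
      w 2 * w 1 < 1 ∧ 0 < w 3 ∧ w 3 < 1) :
    ∃ K' : ℝ, HasDerivAt (fun a => K (Function.update w 0 a)) K' (w 0) ∧ |K'| ≤ s := by
  obtain ⟨-, -, -, -, hb, hb'⟩ := basic hw
  obtain ⟨hθ1, hθ2, h01, -⟩ := hw
  obtain ⟨-, -, dθ⟩ := hasDerivAt_t w
  have hs' : (3:ℝ) ≤ s := by exact_mod_cast hs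
  have hd := ((dθ.fun_mul (hasDerivAt_id' (w 0))).mul_const (w 1)).rpow_const (p := (s:ℝ) - 1)
    (Or.inl hb.ne')
  have hd' : HasDerivAt (fun a => K (Function.update w 0 a)) _ (w 0) :=
    hd.congr_of_eventuallyEq (Filter.Eventually.of_forall fun a => by simp only [hK, update_apply])
  refine ⟨_, hd', ?_⟩
  have hpow : ((1 - w 0 - w 1) * w 0 * w 1) ^ ((s:ℝ) - 1 - 1) ≤ 1 := rpow_le_one hb.le hb'.le (by linarith)
  have hpow0 : 0 ≤ ((1 - w 0 - w 1) * w 0 * w 1) ^ ((s:ℝ) - 1 - 1) := rpow_nonneg hb.le _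
  have hb1 : |(-1 * w 0 + (1 - w 0 - w 1) * 1) * w 1| ≤ 1 := by
    rw [abs_le]; constructor <;> nlinarith
  rw [abs_mul, abs_mul, abs_of_nonneg hpow0, abs_of_nonneg (by linarith : (0:ℝ) ≤ (s:ℝ) - 1)]
  calc |(-1 * w 0 + (1 - w 0 - w 1) * 1) * w 1| * ((s:ℝ) - 1) * ((1 - w 0 - w 1) * w 0 * w 1) ^ ((s:ℝ) - 1 - 1)
      ≤ 1 * ((s:ℝ) - 1) * 1 :=
        mul_le_mul (mul_le_mul_of_nonneg_right hb1 (by linarith)) hpow hpow0 (by nlinarith)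
    _ ≤ s := by linarith

/-- **`∂θ₁ H`** with its compensated bound `|∂θ₁H| · Z² ≤ 117 y` on `W` (quotient rule,
`1/3 ≤ S ≤ 10`, `|∂θ₁S| ≤ y`, `|∂θ₁Z| Z² ≤ y/3`). [folklore] -/
theorem hasDerivAt_H {Z S H : (Fin 4 → ℝ) → ℝ}
    (hZ : ∀ w, Z w = ((1 - w 2 * (1 - w 0 - w 1)) * (1 - w 2 * w 0) * (1 - w 2 * w 1)) ^ ((1:ℝ)/3))
    (hS : ∀ w, S w = 1 - w 2 * ((1 - w 0 - w 1) * w 0 + (1 - w 0 - w 1) * w 1 + w 0 * w 1) +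
      (w 2) ^ 2 * ((1 - w 0 - w 1) * w 0 * w 1))
    (hH : ∀ w, H w = (1 + Z w + Z w ^ 2) / S w) {w : Fin 4 → ℝ}
    (hw : 0 < w 0 ∧ 0 < w 1 ∧ w 0 + w 1 < 1 ∧ 0 < w 2 ∧ w 2 * (1 - w 0 - w 1) < 1 ∧ w 2 * w 0 < 1 ∧
      w 2 * w 1 < 1 ∧ 0 < w 3 ∧ w 3 < 1) :
    ∃ H' : ℝ, HasDerivAt (fun a => H (Function.update w 0 a)) H' (w 0) ∧ |H'| * Z w ^ 2 ≤ 117 * w 2 := by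
  obtain ⟨Z', hZd, hZb⟩ := hasDerivAt_Z hZ hw
  obtain ⟨S', hSd, hSb⟩ := hasDerivAt_S hS hw
  obtain ⟨hz0, hz1⟩ := Z_mem hZ hw
  obtain ⟨hs0, hs1⟩ := S_mem hS hw
  have hy : 0 < w 2 := hw.2.2.2.1
  have hSpos : 0 < S w := by linarith
  have hd := ((hZd.const_add 1).fun_add (hZd.fun_pow 2)).fun_div hSd (by
    simp only [Function.update_eq_self]; exact hSpos.ne')
  simp only [Function.update_eq_self] at hd
  have hd' : HasDerivAt (fun a => H (Function.update w 0 a)) _ (w 0) :=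
    hd.congr_of_eventuallyEq (Filter.Eventually.of_forall fun a => by simp only [hH])
  refine ⟨_, hd', ?_⟩
  rw [abs_div, abs_of_pos (pow_pos hSpos 2), div_mul_eq_mul_div, div_le_iff₀ (pow_pos hSpos 2)]
  have hZ'0 : 0 ≤ |Z'| := abs_nonneg _
  have h1 : |(Z' + ↑(2:ℕ) * Z w ^ (2 - 1) * Z') * S w| * Z w ^ 2 ≤ 10 * w 2 := by
    rw [show (Z' + ↑(2:ℕ) * Z w ^ (2 - 1) * Z') * S w = Z' * ((1 + 2 * Z w) * S w) by norm_num; ring,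
      abs_mul, abs_of_pos (by positivity : (0:ℝ) < (1 + 2 * Z w) * S w)]
    calc |Z'| * ((1 + 2 * Z w) * S w) * Z w ^ 2 = (|Z'| * Z w ^ 2) * ((1 + 2 * Z w) * S w) := by ring
      _ ≤ (w 2 / 3) * (3 * 10) := by
          apply mul_le_mul hZb _ (by positivity) (by positivity)
          nlinarith
      _ = 10 * w 2 := by ring
  have h2 : |(1 + Z w + Z w ^ 2) * S'| * Z w ^ 2 ≤ 3 * w 2 := by
    rw [abs_mul, abs_of_pos (by positivity : (0:ℝ) < 1 + Z w + Z w ^ 2)]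
    calc (1 + Z w + Z w ^ 2) * |S'| * Z w ^ 2 ≤ 3 * w 2 * 1 := by
          apply mul_le_mul (mul_le_mul (by nlinarith) hSb (abs_nonneg _) (by norm_num))
            (by nlinarith) (by positivity) (by positivity)
      _ = 3 * w 2 := by ring
  calc |(Z' + ↑(2:ℕ) * Z w ^ (2 - 1) * Z') * S w - (1 + Z w + Z w ^ 2) * S'| * Z w ^ 2
      ≤ (|(Z' + ↑(2:ℕ) * Z w ^ (2 - 1) * Z') * S w| + |(1 + Z w + Z w ^ 2) * S'|) * Z w ^ 2 := by
        gcongr; exact abs_sub _ _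
    _ ≤ 10 * w 2 + 3 * w 2 := by rw [add_mul]; exact add_le_add h1 h2
    _ ≤ 117 * w 2 * S w ^ 2 := by
        have hS2 : 1/9 ≤ S w ^ 2 := by nlinarith
        nlinarith [mul_le_mul_of_nonneg_left hS2 hy.le]

/-- **`∂θ₁` of a box monomial** `t₀^α t₁^β t₂^γ` (`α, β ∈ [1, x]`, `γ ≥ 0`): it carries the factor
`y = |∂θ₁ t_k|`, `|∂θ₁(t₀^α t₁^β t₂^γ)| ≤ 2xy` on `W`. [folklore] -/
theorem hasDerivAt_monomial {x : ℚ} {α β γ : ℝ} (hα : 1 ≤ α) (hβ : 1 ≤ β) (hγ : 0 ≤ γ) (hαx : α ≤ x)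
    (hβx : β ≤ x) {w : Fin 4 → ℝ}
    (hw : 0 < w 0 ∧ 0 < w 1 ∧ w 0 + w 1 < 1 ∧ 0 < w 2 ∧ w 2 * (1 - w 0 - w 1) < 1 ∧ w 2 * w 0 < 1 ∧
      w 2 * w 1 < 1 ∧ 0 < w 3 ∧ w 3 < 1) :
    ∃ M' : ℝ, HasDerivAt (fun a => (1 - w 2 * (1 - a - w 1)) ^ α * (1 - w 2 * a) ^ β *
      (1 - w 2 * w 1) ^ γ) M' (w 0) ∧ |M'| ≤ 2 * x * w 2 := by
  obtain ⟨-, ⟨h0, h0'⟩, ⟨h1, h1'⟩, ⟨h2, h2'⟩, -⟩ := basic hw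
  have hy : 0 < w 2 := hw.2.2.2.1
  obtain ⟨dt0, dt1, -⟩ := hasDerivAt_t w
  have hd := ((dt0.rpow_const (p := α) (Or.inl h0.ne')).fun_mul
    (dt1.rpow_const (p := β) (Or.inl h1.ne'))).mul_const ((1 - w 2 * w 1) ^ γ)
  refine ⟨_, hd, ?_⟩
  have hα0 : 0 < α := by linarith
  have hβ0 : 0 < β := by linarith
  have hx0 : (0:ℝ) < x := by linarith
  have p0 : (1 - w 2 * (1 - w 0 - w 1)) ^ (α - 1) ≤ 1 := rpow_le_one h0.le h0'.le (by linarith)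
  have p1 : (1 - w 2 * w 0) ^ β ≤ 1 := rpow_le_one h1.le h1'.le (by linarith)
  have p2 : (1 - w 2 * (1 - w 0 - w 1)) ^ α ≤ 1 := rpow_le_one h0.le h0'.le (by linarith)
  have p3 : (1 - w 2 * w 0) ^ (β - 1) ≤ 1 := rpow_le_one h1.le h1'.le (by linarith)
  have p4 : (1 - w 2 * w 1) ^ γ ≤ 1 := rpow_le_one h2.le h2'.le hγ
  have q0 : 0 ≤ (1 - w 2 * (1 - w 0 - w 1)) ^ (α - 1) := rpow_nonneg h0.le _
  have q1 : 0 ≤ (1 - w 2 * w 0) ^ β := rpow_nonneg h1.le _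
  have q2 : 0 ≤ (1 - w 2 * (1 - w 0 - w 1)) ^ α := rpow_nonneg h0.le _
  have q3 : 0 ≤ (1 - w 2 * w 0) ^ (β - 1) := rpow_nonneg h1.le _
  have q4 : 0 ≤ (1 - w 2 * w 1) ^ γ := rpow_nonneg h2.le _
  have hA : |w 2 * α * (1 - w 2 * (1 - w 0 - w 1)) ^ (α - 1) * (1 - w 2 * w 0) ^ β| ≤ w 2 * x := by
    rw [abs_of_nonneg (by positivity)]
    calc w 2 * α * (1 - w 2 * (1 - w 0 - w 1)) ^ (α - 1) * (1 - w 2 * w 0) ^ β ≤ w 2 * x * 1 * 1 := by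
          gcongr
      _ = w 2 * x := by ring
  have hB : |(1 - w 2 * (1 - w 0 - w 1)) ^ α * (-w 2 * β * (1 - w 2 * w 0) ^ (β - 1))| ≤ w 2 * x := by
    rw [show (1 - w 2 * (1 - w 0 - w 1)) ^ α * (-w 2 * β * (1 - w 2 * w 0) ^ (β - 1)) =
      -((1 - w 2 * (1 - w 0 - w 1)) ^ α * (w 2 * β * (1 - w 2 * w 0) ^ (β - 1))) by ring, abs_neg,
      abs_of_nonneg (by positivity)]
    calc (1 - w 2 * (1 - w 0 - w 1)) ^ α * (w 2 * β * (1 - w 2 * w 0) ^ (β - 1)) ≤ 1 * (w 2 * x * 1) := by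
          gcongr
      _ = w 2 * x := by ring
  rw [abs_mul, abs_of_nonneg q4]
  calc |w 2 * α * (1 - w 2 * (1 - w 0 - w 1)) ^ (α - 1) * (1 - w 2 * w 0) ^ β +
        (1 - w 2 * (1 - w 0 - w 1)) ^ α * (-w 2 * β * (1 - w 2 * w 0) ^ (β - 1))| * (1 - w 2 * w 1) ^ γ
      ≤ (w 2 * x + w 2 * x) * 1 := by
        apply mul_le_mul ((abs_add_le _ _).trans (add_le_add hA hB)) p4 q4 (by positivity)
    _ = 2 * x * w 2 := by ring

/-- **`∂θ₁ B`** for the bracket `B = θ₀M0 − (1−θ₁)M1 + θ₂M2`: `∂θ₁B = (M1 − M0) + θ₀∂M0 − (1−θ₁)∂M1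
+ θ₂∂M2`, `|∂θ₁B| ≤ 6xy` on `W`. [folklore] -/
theorem hasDerivAt_B {x : ℚ} (hx : 2 ≤ x) {Z M0 M1 M2 : (Fin 4 → ℝ) → ℝ}
    (hZ : ∀ w, Z w = ((1 - w 2 * (1 - w 0 - w 1)) * (1 - w 2 * w 0) * (1 - w 2 * w 1)) ^ ((1:ℝ)/3))
    (hM0 : ∀ w, M0 w = (1 - w 2 * (1 - w 0 - w 1)) ^ (x:ℝ) * (1 - w 2 * w 0) ^ ((x:ℝ) - 2/3) *
      (1 - w 2 * w 1) ^ ((x:ℝ) - 1/3))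
    (hM1 : ∀ w, M1 w = (1 - w 2 * (1 - w 0 - w 1)) ^ ((x:ℝ) - 1/3) * (1 - w 2 * w 0) ^ (x:ℝ) *
      (1 - w 2 * w 1) ^ ((x:ℝ) - 2/3))
    (hM2 : ∀ w, M2 w = (1 - w 2 * (1 - w 0 - w 1)) ^ ((x:ℝ) - 2/3) * (1 - w 2 * w 0) ^ ((x:ℝ) - 1/3) *
      (1 - w 2 * w 1) ^ (x:ℝ))
    {w : Fin 4 → ℝ}
    (hw : 0 < w 0 ∧ 0 < w 1 ∧ w 0 + w 1 < 1 ∧ 0 < w 2 ∧ w 2 * (1 - w 0 - w 1) < 1 ∧ w 2 * w 0 < 1 ∧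
      w 2 * w 1 < 1 ∧ 0 < w 3 ∧ w 3 < 1) :
    ∃ B' : ℝ, HasDerivAt (fun a => (1 - a - w 1) * M0 (Function.update w 0 a) -
      (1 - a) * M1 (Function.update w 0 a) + w 1 * M2 (Function.update w 0 a)) B' (w 0) ∧
      |B'| ≤ 6 * x * w 2 := by
  have hx' : (2:ℝ) ≤ x := by exact_mod_cast hx
  obtain ⟨⟨-, a1, -, a3⟩, ⟨-, b1, -, b3⟩, -⟩ := M_mem hx hZ hM0 hM1 hM2 hw
  obtain ⟨M0', d0, e0⟩ := hasDerivAt_monomial (α := (x:ℝ)) (β := (x:ℝ) - 2/3) (γ := (x:ℝ) - 1/3)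
    (by linarith) (by linarith) (by linarith) le_rfl (by linarith) hw
  obtain ⟨M1', d1, e1⟩ := hasDerivAt_monomial (α := (x:ℝ) - 1/3) (β := (x:ℝ)) (γ := (x:ℝ) - 2/3)
    (by linarith) (by linarith) (by linarith) (by linarith) le_rfl hw
  obtain ⟨M2', d2, e2⟩ := hasDerivAt_monomial (x := x) (α := (x:ℝ) - 2/3) (β := (x:ℝ) - 1/3)
    (γ := (x:ℝ)) (by linarith) (by linarith) (by linarith) (by linarith) (by linarith) hw
  have d0' : HasDerivAt (fun a => M0 (Function.update w 0 a)) M0' (w 0) :=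
    d0.congr_of_eventuallyEq (Filter.Eventually.of_forall fun a => by simp only [hM0, update_apply])
  have d1' : HasDerivAt (fun a => M1 (Function.update w 0 a)) M1' (w 0) :=
    d1.congr_of_eventuallyEq (Filter.Eventually.of_forall fun a => by simp only [hM1, update_apply])
  have d2' : HasDerivAt (fun a => M2 (Function.update w 0 a)) M2' (w 0) :=
    d2.congr_of_eventuallyEq (Filter.Eventually.of_forall fun a => by simp only [hM2, update_apply])
  obtain ⟨-, -, dθ⟩ := hasDerivAt_t w
  have d1a : HasDerivAt (fun a => 1 - a) (-1) (w 0) := (hasDerivAt_id' (w 0)).const_sub 1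
  have hd := ((dθ.fun_mul d0').fun_sub (d1a.fun_mul d1')).fun_add (d2'.const_mul (w 1))
  simp only [Function.update_eq_self] at hd
  refine ⟨_, hd, ?_⟩
  obtain ⟨hθ1, hθ2, h01, hy, -⟩ := hw
  have hθ0 : 0 < 1 - w 0 - w 1 := by linarith
  have hdiff : |M1 w - M0 w| ≤ x * w 2 := by rw [abs_le]; constructor <;> linarith
  have hxy : 0 ≤ (x:ℝ) * w 2 := by positivity
  have h1w0 : (0:ℝ) ≤ 1 - w 0 := by linarith
  calc |-1 * M0 w + (1 - w 0 - w 1) * M0' - (-1 * M1 w + (1 - w 0) * M1') + w 1 * M2'|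
      = |(M1 w - M0 w) + (1 - w 0 - w 1) * M0' + (-(1 - w 0)) * M1' + w 1 * M2'| := by ring_nf
    _ ≤ |M1 w - M0 w| + |(1 - w 0 - w 1) * M0'| + |(-(1 - w 0)) * M1'| + |w 1 * M2'| := by
        refine (abs_add_le _ _).trans (add_le_add ((abs_add_le _ _).trans (add_le_add (abs_add_le _ _) le_rfl)) le_rfl)
    _ ≤ x * w 2 + (1 - w 0 - w 1) * (2 * x * w 2) + (1 - w 0) * (2 * x * w 2) + w 1 * (2 * x * w 2) := by
        rw [abs_mul, abs_mul, abs_mul, abs_of_pos hθ0, abs_neg, abs_of_pos (by linarith : (0:ℝ) < 1 - w 0),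
          abs_of_pos hθ2]
        gcongr
    _ ≤ 6 * x * w 2 := by nlinarith

/-- **`∂θ₁ P`** split as `P₁ + P₂`: `P₁` (the `(1 − vZ)^{3s−1}`- and `H^{3s}`-terms) carries `∂θ₁Z`,
`∂θ₁S` and satisfies the compensated bound `|P₁| Z² ≤ 352·s·9^{3s}·y`; `P₂` (the `K`-term) is
bounded, `|P₂| ≤ s·9^{3s}`. [folklore] -/
theorem hasDerivAt_P {x s : ℚ} (hx : 2 ≤ x) (hs : 3 ≤ s) {Z S H K P : (Fin 4 → ℝ) → ℝ}
    (hZ : ∀ w, Z w = ((1 - w 2 * (1 - w 0 - w 1)) * (1 - w 2 * w 0) * (1 - w 2 * w 1)) ^ ((1:ℝ)/3))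
    (hS : ∀ w, S w = 1 - w 2 * ((1 - w 0 - w 1) * w 0 + (1 - w 0 - w 1) * w 1 + w 0 * w 1) +
      (w 2) ^ 2 * ((1 - w 0 - w 1) * w 0 * w 1))
    (hH : ∀ w, H w = (1 + Z w + Z w ^ 2) / S w)
    (hK : ∀ w, K w = ((1 - w 0 - w 1) * w 0 * w 1) ^ ((s:ℝ) - 1))
    (hP : ∀ w, P w = (w 3) ^ (3 * (x:ℝ) - 1) * (1 - w 3 * Z w) ^ (3 * (s:ℝ) - 1) * H w ^ (3 * (s:ℝ)) *
      K w) {w : Fin 4 → ℝ}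
    (hw : 0 < w 0 ∧ 0 < w 1 ∧ w 0 + w 1 < 1 ∧ 0 < w 2 ∧ w 2 * (1 - w 0 - w 1) < 1 ∧ w 2 * w 0 < 1 ∧
      w 2 * w 1 < 1 ∧ 0 < w 3 ∧ w 3 < 1) :
    ∃ P₁ P₂ : ℝ, HasDerivAt (fun a => P (Function.update w 0 a)) (P₁ + P₂) (w 0) ∧
      |P₁| * Z w ^ 2 ≤ 352 * s * 9 ^ (3 * (s:ℝ)) * w 2 ∧ |P₂| ≤ s * 9 ^ (3 * (s:ℝ)) := by
  obtain ⟨Z', hZd, hZb⟩ := hasDerivAt_Z hZ hw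
  obtain ⟨H', hHd, hHb⟩ := hasDerivAt_H hZ hS hH hw
  obtain ⟨K', hKd, hKb⟩ := hasDerivAt_K hs hK hw
  obtain ⟨⟨c0, c1⟩, ⟨q0, q1⟩, ⟨r0, r1⟩, ⟨r0', r1'⟩⟩ := P_pieces hx hs hZ hS hH hw
  obtain ⟨k0, k1⟩ := K_mem hs hK hw
  obtain ⟨hh0, -⟩ := H_mem hZ hS hH hw
  have hs' : (3:ℝ) ≤ s := by exact_mod_cast hs
  have hy : 0 < w 2 := hw.2.2.2.1
  have hv0 : 0 < w 3 := hw.2.2.2.2.2.2.2.1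
  have hv1 : w 3 < 1 := hw.2.2.2.2.2.2.2.2
  have hQ := ((hZd.const_mul (w 3)).const_sub 1).rpow_const (p := 3 * (s:ℝ) - 1) (Or.inl (by
    simp only [Function.update_eq_self]; exact q0.ne'))
  have hR := hHd.rpow_const (p := 3 * (s:ℝ)) (Or.inl (by simp only [Function.update_eq_self]; exact hh0.ne'))
  have hd := ((hQ.const_mul ((w 3) ^ (3 * (x:ℝ) - 1))).fun_mul hR).fun_mul hKd
  simp only [Function.update_eq_self] at hd
  have hd' : HasDerivAt (fun a => P (Function.update w 0 a)) _ (w 0) :=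
    hd.congr_of_eventuallyEq (Filter.Eventually.of_forall fun a => by simp only [hP, update_apply])
  refine ⟨_, _, hd', ?_, ?_⟩
  · -- the `(1 − vZ)`- and `H`-terms
    set G := (9:ℝ) ^ (3 * (s:ℝ)) with hG
    have hG1 : 0 ≤ G := by positivity
    have h3s1 : (0:ℝ) ≤ 3 * (s:ℝ) - 1 := by linarith
    have h3s : (0:ℝ) ≤ 3 * (s:ℝ) := by linarith
    have hle : 3 * (s:ℝ) - 1 ≤ 3 * s := by linarith
    have qq0 : 0 ≤ (1 - w 3 * Z w) ^ (3 * (s:ℝ) - 1 - 1) := rpow_nonneg q0.le _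
    have qq1 : (1 - w 3 * Z w) ^ (3 * (s:ℝ) - 1 - 1) ≤ 1 := rpow_le_one q0.le q1 (by linarith)
    have hQ0 : 0 ≤ (1 - w 3 * Z w) ^ (3 * (s:ℝ) - 1) := rpow_nonneg q0.le _
    have hQ1 : (1 - w 3 * Z w) ^ (3 * (s:ℝ) - 1) ≤ 1 := rpow_le_one q0.le q1 (by linarith)
    have hz2 : 0 ≤ Z w ^ 2 := sq_nonneg _
    have ha1 : w 3 ^ (3 * (x:ℝ) - 1) * w 3 * (1 - w 3 * Z w) ^ (3 * (s:ℝ) - 1 - 1) ≤ 1 :=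
      calc w 3 ^ (3 * (x:ℝ) - 1) * w 3 * (1 - w 3 * Z w) ^ (3 * (s:ℝ) - 1 - 1) ≤ 1 * 1 * 1 := by
            gcongr
        _ = 1 := by ring
    have ha2 : w 3 ^ (3 * (x:ℝ) - 1) * (1 - w 3 * Z w) ^ (3 * (s:ℝ) - 1) ≤ 1 :=
      calc w 3 ^ (3 * (x:ℝ) - 1) * (1 - w 3 * Z w) ^ (3 * (s:ℝ) - 1) ≤ 1 * 1 := by gcongr
        _ = 1 := by ring
    have ha10 : 0 ≤ w 3 ^ (3 * (x:ℝ) - 1) * w 3 * (1 - w 3 * Z w) ^ (3 * (s:ℝ) - 1 - 1) := by positivity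
    have ha20 : 0 ≤ w 3 ^ (3 * (x:ℝ) - 1) * (1 - w 3 * Z w) ^ (3 * (s:ℝ) - 1) := by positivity
    -- first term
    have t1 : |w 3 ^ (3 * (x:ℝ) - 1) * (-(w 3 * Z') * (3 * (s:ℝ) - 1) *
        (1 - w 3 * Z w) ^ (3 * (s:ℝ) - 1 - 1)) * H w ^ (3 * (s:ℝ))| * Z w ^ 2 ≤ (3 * s) * G * (w 2 / 3) := by
      rw [abs_mul, abs_mul, abs_mul, abs_mul, abs_neg, abs_mul, abs_of_nonneg c0, abs_of_pos hv0,
        abs_of_nonneg h3s1, abs_of_nonneg qq0, abs_of_nonneg r0]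
      calc w 3 ^ (3 * (x:ℝ) - 1) * (w 3 * |Z'| * (3 * (s:ℝ) - 1) * (1 - w 3 * Z w) ^ (3 * (s:ℝ) - 1 - 1)) *
            H w ^ (3 * (s:ℝ)) * Z w ^ 2
          = (w 3 ^ (3 * (x:ℝ) - 1) * w 3 * (1 - w 3 * Z w) ^ (3 * (s:ℝ) - 1 - 1)) * (3 * (s:ℝ) - 1) *
            H w ^ (3 * (s:ℝ)) * (|Z'| * Z w ^ 2) := by ring
        _ ≤ 1 * (3 * s) * G * (w 2 / 3) := by gcongr
        _ = (3 * s) * G * (w 2 / 3) := by ring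
    -- second term
    have t2 : |w 3 ^ (3 * (x:ℝ) - 1) * (1 - w 3 * Z w) ^ (3 * (s:ℝ) - 1) *
        (H' * (3 * (s:ℝ)) * H w ^ (3 * (s:ℝ) - 1))| * Z w ^ 2 ≤ (3 * s) * G * (117 * w 2) := by
      rw [abs_mul, abs_mul, abs_mul, abs_mul, abs_of_nonneg c0, abs_of_nonneg hQ0,
        abs_of_nonneg h3s, abs_of_nonneg r0']
      calc w 3 ^ (3 * (x:ℝ) - 1) * (1 - w 3 * Z w) ^ (3 * (s:ℝ) - 1) * (|H'| * (3 * (s:ℝ)) *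
            H w ^ (3 * (s:ℝ) - 1)) * Z w ^ 2
          = (w 3 ^ (3 * (x:ℝ) - 1) * (1 - w 3 * Z w) ^ (3 * (s:ℝ) - 1)) * (3 * (s:ℝ)) *
            H w ^ (3 * (s:ℝ) - 1) * (|H'| * Z w ^ 2) := by ring
        _ ≤ 1 * (3 * s) * G * (117 * w 2) := by gcongr
        _ = (3 * s) * G * (117 * w 2) := by ring
    calc |(w 3 ^ (3 * (x:ℝ) - 1) * (-(w 3 * Z') * (3 * (s:ℝ) - 1) * (1 - w 3 * Z w) ^ (3 * (s:ℝ) - 1 - 1)) *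
          H w ^ (3 * (s:ℝ)) + w 3 ^ (3 * (x:ℝ) - 1) * (1 - w 3 * Z w) ^ (3 * (s:ℝ) - 1) *
          (H' * (3 * (s:ℝ)) * H w ^ (3 * (s:ℝ) - 1))) * K w| * Z w ^ 2
        ≤ (|w 3 ^ (3 * (x:ℝ) - 1) * (-(w 3 * Z') * (3 * (s:ℝ) - 1) * (1 - w 3 * Z w) ^ (3 * (s:ℝ) - 1 - 1)) *
          H w ^ (3 * (s:ℝ))| + |w 3 ^ (3 * (x:ℝ) - 1) * (1 - w 3 * Z w) ^ (3 * (s:ℝ) - 1) *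
          (H' * (3 * (s:ℝ)) * H w ^ (3 * (s:ℝ) - 1))|) * 1 * Z w ^ 2 := by
          rw [abs_mul, abs_of_nonneg k0.le]
          gcongr
          exact abs_add_le _ _
      _ = |w 3 ^ (3 * (x:ℝ) - 1) * (-(w 3 * Z') * (3 * (s:ℝ) - 1) * (1 - w 3 * Z w) ^ (3 * (s:ℝ) - 1 - 1)) *
          H w ^ (3 * (s:ℝ))| * Z w ^ 2 + |w 3 ^ (3 * (x:ℝ) - 1) * (1 - w 3 * Z w) ^ (3 * (s:ℝ) - 1) *
          (H' * (3 * (s:ℝ)) * H w ^ (3 * (s:ℝ) - 1))| * Z w ^ 2 := by ring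
      _ ≤ (3 * s) * G * (w 2 / 3) + (3 * s) * G * (117 * w 2) := add_le_add t1 t2
      _ = 352 * s * G * w 2 := by ring
  · have hQ0 : 0 ≤ (1 - w 3 * Z w) ^ (3 * (s:ℝ) - 1) := rpow_nonneg q0.le _
    have hQ1 : (1 - w 3 * Z w) ^ (3 * (s:ℝ) - 1) ≤ 1 := rpow_le_one q0.le q1 (by linarith)
    have hs0 : (0:ℝ) ≤ s := by linarith
    rw [abs_mul, abs_of_nonneg (by positivity)]
    calc w 3 ^ (3 * (x:ℝ) - 1) * (1 - w 3 * Z w) ^ (3 * (s:ℝ) - 1) * H w ^ (3 * (s:ℝ)) * |K'|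
        ≤ 1 * 1 * 9 ^ (3 * (s:ℝ)) * s := by gcongr
      _ = s * 9 ^ (3 * (s:ℝ)) := by ring

end CornerTheta1

/-- **`θ₁`-derivatives of the prefactor `P` and of the bracket of `c₀`, with the bounds absorbing
`1/y`** (sub-goal `cornerStokesTheta1Deriv` of `stub_gmThreeShifted`, `x ≥ 2`, `s ≥ 3`).
[cite: KontsevichZagier2001, §1.2 rule (3)] -/
theorem cornerStokesTheta1Deriv : ∀ (x s : ℚ), 2 ≤ x → 3 ≤ s → ∀ (Z S H K M0 M1 M2 P : (Fin 4 → ℝ) → ℝ),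
    (∀ w, Z w = ((1 - w 2 * (1 - w 0 - w 1)) * (1 - w 2 * w 0) * (1 - w 2 * w 1)) ^ ((1:ℝ)/3)) →
    (∀ w, S w = 1 - w 2 * ((1 - w 0 - w 1) * w 0 + (1 - w 0 - w 1) * w 1 + w 0 * w 1) +
      (w 2) ^ 2 * ((1 - w 0 - w 1) * w 0 * w 1)) →
    (∀ w, H w = (1 + Z w + Z w ^ 2) / S w) →
    (∀ w, K w = ((1 - w 0 - w 1) * w 0 * w 1) ^ ((s:ℝ) - 1)) →
    (∀ w, M0 w = (1 - w 2 * (1 - w 0 - w 1)) ^ (x:ℝ) * (1 - w 2 * w 0) ^ ((x:ℝ) - 2/3) * (1 - w 2 * w 1) ^ ((x:ℝ) - 1/3)) →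
    (∀ w, M1 w = (1 - w 2 * (1 - w 0 - w 1)) ^ ((x:ℝ) - 1/3) * (1 - w 2 * w 0) ^ (x:ℝ) * (1 - w 2 * w 1) ^ ((x:ℝ) - 2/3)) →
    (∀ w, M2 w = (1 - w 2 * (1 - w 0 - w 1)) ^ ((x:ℝ) - 2/3) * (1 - w 2 * w 0) ^ ((x:ℝ) - 1/3) * (1 - w 2 * w 1) ^ (x:ℝ)) →
    (∀ w, P w = (w 3) ^ (3 * (x:ℝ) - 1) * (1 - w 3 * Z w) ^ (3 * (s:ℝ) - 1) * H w ^ (3 * (s:ℝ)) * K w) →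
    ∀ w ∈ {w : Fin 4 → ℝ | 0 < w 0 ∧ 0 < w 1 ∧ w 0 + w 1 < 1 ∧ 0 < w 2 ∧ w 2 * (1 - w 0 - w 1) < 1 ∧ w 2 * w 0 < 1 ∧ w 2 * w 1 < 1 ∧ 0 < w 3 ∧ w 3 < 1},
      (∃ P₁ P₂ : ℝ, HasDerivAt (fun a => P (Function.update w 0 a)) (P₁ + P₂) (w 0) ∧
        |P₁| * Z w ^ 2 ≤ 352 * s * 9 ^ (3 * (s:ℝ)) * w 2 ∧ |P₂| ≤ s * 9 ^ (3 * (s:ℝ))) ∧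
      (∃ B' : ℝ, HasDerivAt (fun a => (1 - a - w 1) * M0 (Function.update w 0 a) -
        (1 - a) * M1 (Function.update w 0 a) + w 1 * M2 (Function.update w 0 a)) B' (w 0) ∧ |B'| ≤ 6 * x * w 2) :=
  fun _ _ hx hs _ _ _ _ _ _ _ _ hZ hS hH hK hM0 hM1 hM2 hP _ hw =>
    ⟨CornerTheta1.hasDerivAt_P hx hs hZ hS hH hK hP hw, CornerTheta1.hasDerivAt_B hx hZ hM0 hM1 hM2 hw⟩

end Summit.KontsevichZagierPeriods.TerasomaMultiplication.MultiplicationAccessible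

end
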